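import Literature.NumberTheory.LFunctions.GaussianThetaLValueOne
import Literature.NumberTheory.EllipticCurves.GaussianLatticeKroneckerLimit
import Literature.NumberTheory.EllipticCurves.GaussianLatticeQuarterValues
import Literature.NumberTheory.EllipticCurves.CongruentNumberCurveLSeriesProofs
import HarnessLib

/-!
# `L(E_n, 1)` as a finite sum of Eisenstein–Kronecker numbers of `ℤi + ℤ`

Topic `Literature/NumberTheory/EllipticCurves` (the Tunnell / congruent-number cluster). Filed for
the named facts `Literature.NumberTheory.EllipticCurves.BirchSwinnertonDyer1965_L_one_two_ten` and
`…_one_one_three` of `BSDAnalyticRankTunnellWaldspurgerProofs` (the four CM `L`-values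
`L(E₁, 1) = β/4`, `L(E₃, 1) = β/√3`, `L(E₂, 1) = β/(2√2)`, `L(E₁₀, 1) = 2β/√10` that fix the
constants in Tunnell's Theorem 3, Invent. Math. 72 (1983), p. 329, read off
Birch–Swinnerton-Dyer, *Notes on elliptic curves II*, Crelle 218 (1965), Table 1). It joins three
proved inputs of the tree into the **finite formula for `L(E_n, 1)`** from which those values are
computed (Birch–Swinnerton-Dyer 1965, §3, `L_D(1)` as a finite sum of Weierstrass-function
values of the lemniscatic lattice):

* `LFunctions.GaussianThetaLValueOne` — `L_ψ(1) = lim_{y→0⁺} Σ_{x ∈ ℤ[i]} ψ(x)(x/N x)e^{-yN(x)}`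
  for the weight-one theta `L`-series `L_ψ = thetaLFunction M ψ` of a coefficient `ψ` periodic
  modulo `M` (`tendsto_tsum_thetaLFunction_one`);
* `GaussianLatticeKroneckerLimit` — Kronecker's limit formula in weight one:
  `Σ_{l ∈ ℤi+ℤ} e^{-ε|z−l|²}/(z − l) → ζ(z) − π z̄` (`GaussianLattice.tendsto_tsum_exp_div_sub`);
* `GaussianLatticeQuarterValues` — `E₁*(z) = ζ_{ℤi+ℤ}(z) − π z̄` (`GaussianLattice.kroneckerE₁`);

and `CongruentNumberCurveHeckeSeries` / `…LSeriesProofs` (`L(E_n, s) = ¼ L_{ψ_n}(s)`,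
`ψ_n = heckePsi n`, the continuation being a theorem). Results (all proved; the only definition
is the bijection `gaussianIntEquivLattice : ℤ[i] ≃ ℤi + ℤ`):

* `hasSum_sum_classes` — a convergent sum over `ℤ[i]` split over the `M²` classes modulo `M`;
* `tsum_class_eq`, `tendsto_tsum_class` — the class of `c₀` contributes
  `ψ(c₀) · conj(M⁻¹ Σ_l e^{-M²y|c₀/M + l|²}/(c₀/M + l)) → ψ(c₀) conj(E₁*(c₀/M))/M`
  (`x/N(x) = conj(x⁻¹)`, `c₀ + Mμ = M(c₀/M + μ)`, Kronecker's formula at `z = c₀/M`);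
* `thetaLFunction_one_eq_sum_kroneckerE₁` — **`L_ψ(1) = M⁻¹ Σ_{c mod M} ψ(c) conj(E₁*(c/M))`**;
* `entireLFunction_congruentNumberCurve_eq_of_period` — `L(E_n, s) = ¼ thetaLFunction M ψ_n s` for EVERY
  period `M` of `ψ_n` (uniqueness of the entire continuation), and
  `entireLFunction_congruentNumberCurve_one_eq_sum` —
  **`L(E_n, 1) = (4M)⁻¹ Σ_{c mod M} ψ_n(c) conj(E₁*(c/M))`** for `n` squarefree.

With the quarter values of `GaussianLatticeQuarterValues` this gives `L(E₁, 1)`, `L(E₂, 1)`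
(`M = 4`; sibling file); `L(E₃, 1)`, `L(E₁₀, 1)` need the `12`- and `20`-division values.

## References

* B. J. Birch, H. P. F. Swinnerton-Dyer, *Notes on elliptic curves. II*, J. reine angew. Math. 218
  (1965) 79–108, §3 and Table 1.
* J. B. Tunnell, *A classical Diophantine problem and modular forms of weight 3/2*, Invent. Math.
  72 (1983), proof of Thm 3, p. 329.
* A. Weil, *Elliptic Functions according to Eisenstein and Kronecker*, Springer 1976, Ch. VIII.
-/

noncomputable section

open Complex Real Set Filter Topology PeriodPair
open scoped Real Topology PeriodPair ComplexConjugate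

namespace Literature.NumberTheory.EllipticCurves

open Literature.NumberTheory.LFunctions Literature.NumberTheory.LFunctions.GaussianTheta
  GaussianLattice

local notation "Λᵢ" => PeriodPair.ofUpperHalfPlane UpperHalfPlane.I

local notation "ℤ[i]" => GaussianInt

/-! ### Gaussian integers as points of the lattice `ℤi + ℤ` -/

/-- The bijection `ℤ[i] ≃ ℤi + ℤ`, `a + bi ↦ b·i + a` (through Mathlib's `latticeEquivProd`).
[folklore] -/
def gaussianIntEquivLattice : ℤ[i] ≃ (Λᵢ).lattice :=
  (⟨fun x ↦ (x.im, x.re), fun p ↦ ⟨p.2, p.1⟩, fun x ↦ by ext <;> rfl, fun p ↦ by rfl⟩ :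
      ℤ[i] ≃ ℤ × ℤ).trans (Λᵢ).latticeEquivProd.symm.toEquiv

/-- `gaussianIntEquivLattice x = x` as complex numbers. [folklore] -/
@[simp] theorem coe_gaussianIntEquivLattice (x : ℤ[i]) :
    ((gaussianIntEquivLattice x : (Λᵢ).lattice) : ℂ) = (x : ℂ) := by
  simp only [gaussianIntEquivLattice, Equiv.trans_apply, Equiv.coe_fn_mk, LinearEquiv.coe_toEquiv]
  rw [GaussianLattice.coe_latticeEquivProd_symm, GaussianInt.toComplex_def₂]
  apply Complex.ext <;> simp

/-- `‖x‖² = N(x)` for a Gaussian integer, as real numbers. [folklore] -/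
theorem norm_toComplex_sq (x : ℤ[i]) : ‖(x : ℂ)‖ ^ 2 = ((x.norm : ℤ) : ℝ) := by
  rw [Complex.sq_norm, ← GaussianInt.intCast_real_norm]

/-- `x / N(x) = conj(x⁻¹)` in `ℂ` (`N(x) = x x̄`; both sides vanish at `x = 0`). [folklore] -/
theorem toComplex_div_norm (x : ℤ[i]) :
    (x : ℂ) / ((x.norm : ℤ) : ℂ) = conj ((x : ℂ)⁻¹) := by
  rcases eq_or_ne x 0 with rfl | hx
  · simp
  · have hx' : (x : ℂ) ≠ 0 := by rwa [Ne, GaussianInt.toComplex_eq_zero]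
    have hN : ((x.norm : ℤ) : ℂ) = (x : ℂ) * conj (x : ℂ) := by
      rw [Complex.mul_conj, ← Complex.ofReal_intCast, GaussianInt.intCast_real_norm]
    have hc : conj (x : ℂ) ≠ 0 := (map_ne_zero _).mpr hx'
    rw [hN, map_inv₀]
    field_simp

/-! ### Class decomposition of a sum over `ℤ[i]` -/

section Classes

variable (M : ℕ) [NeZero M]

/-- **A convergent sum over `ℤ[i]` is the sum over the classes modulo `M`** (each class
parametrised by `rep M c : ℤ × ℤ → ℤ[i]`). [folklore] -/
theorem hasSum_sum_classes {F : ℤ[i] → ℂ} (hF : Summable F) :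
    HasSum F (∑ c : ZMod M × ZMod M, ∑' y : ℤ × ℤ, F (rep M c y)) := by
  classical
  have key : ∀ c : ZMod M × ZMod M,
      HasSum (fun x ↦ if cls M x = c then F x else 0) (∑' y : ℤ × ℤ, F (rep M c y)) := by
    intro c
    have hoff : ∀ x ∉ Set.range (rep M c), (fun x ↦ if cls M x = c then F x else 0) x = 0 := by
      intro x hx
      rw [range_rep] at hx
      exact if_neg hx
    refine ((rep_injective M c).hasSum_iff hoff).mp ?_
    have heq : ((fun x ↦ if cls M x = c then F x else 0) ∘ rep M c) = fun y ↦ F (rep M c y) := by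
      funext y
      simp only [Function.comp_apply, cls_rep, if_true]
    rw [heq]
    exact (hF.comp_injective (rep_injective M c)).hasSum
  have h := hasSum_sum (s := (Finset.univ : Finset (ZMod M × ZMod M))) fun c _ ↦ key c
  refine h.congr_fun fun x ↦ ?_
  simp only [Finset.sum_ite_eq, Finset.mem_univ, if_true]

/-- `rep M c y = c₀ + M w` with `c₀ = rep M c 0` and `w = y₁ + y₂ i`, as complex numbers. [folklore] -/
theorem toComplex_rep (c : ZMod M × ZMod M) (y : ℤ × ℤ) :
    ((rep M c y : ℤ[i]) : ℂ) = (rep M c 0 : ℂ) + (M : ℂ) * ((y.2 : ℂ) * I + y.1) := by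
  rw [rep_eq_rep_zero_add M c y, GaussianInt.toComplex_add, GaussianInt.toComplex_mul]
  congr 1
  rw [GaussianInt.toComplex_def₂, GaussianInt.toComplex_def₂]
  apply Complex.ext <;> simp

end Classes

/-! ### The class sums and their limits -/

section ClassSums

variable (M : ℕ) [NeZero M] (ψ : ℤ[i] → ℂ)

/-- The summand of `GaussianTheta.tendsto_tsum_thetaLFunction_one` through `conj(x⁻¹)`:
`ψ(x) (x/N(x)) e^{-yN(x)} = ψ(x) · conj(e^{-y‖x‖²}/x)`. [folklore] -/
theorem summand_eq (y : ℝ) (x : ℤ[i]) :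
    ψ x * (x : ℂ) / ((x.norm : ℤ) : ℂ) * ((rexp (-y * ((x.norm : ℤ) : ℝ)) : ℝ) : ℂ) =
      ψ x * conj (((rexp (-y * ‖(x : ℂ)‖ ^ 2) : ℝ) : ℂ) / (x : ℂ)) := by
  rw [norm_toComplex_sq, map_div₀, Complex.conj_ofReal, mul_div_assoc, toComplex_div_norm,
    map_inv₀]
  ring

/-- **The class sum through the lattice `ℤi + ℤ`**: for `ψ` periodic modulo `M`, the part of
`∑_x ψ(x)(x/N(x))e^{-yN(x)}` over the class of `c₀ = rep M c 0` is
`ψ(c₀) · conj( M⁻¹ ∑_{l ∈ ℤi+ℤ} e^{-M²y |c₀/M + l|²}/(c₀/M + l) )`. [folklore] -/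
theorem tsum_class_eq (hψ : ∀ x y : ℤ[i], ψ (x + M * y) = ψ x) (c : ZMod M × ZMod M) (y : ℝ) :
    ∑' p : ℤ × ℤ, ψ (rep M c p) * (rep M c p : ℂ) / (((rep M c p).norm : ℤ) : ℂ) *
        ((rexp (-y * (((rep M c p).norm : ℤ) : ℝ)) : ℝ) : ℂ) =
      ψ (rep M c 0) * conj ((M : ℂ)⁻¹ * ∑' l : (Λᵢ).lattice,
        ((rexp (-(M ^ 2 * y) * ‖(rep M c 0 : ℂ) / M + (l : ℂ)‖ ^ 2) : ℝ) : ℂ) /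
          ((rep M c 0 : ℂ) / M + (l : ℂ))) := by
  have hM : (M : ℂ) ≠ 0 := Nat.cast_ne_zero.mpr (NeZero.ne M)
  have hMr : (0 : ℝ) < M := by exact_mod_cast Nat.pos_of_ne_zero (NeZero.ne M)
  -- periodicity of `ψ` on the class
  have hψc : ∀ p : ℤ × ℤ, ψ (rep M c p) = ψ (rep M c 0) := by
    intro p
    rw [rep_eq_rep_zero_add M c p, hψ]
  simp_rw [summand_eq, hψc]
  rw [tsum_mul_left, ← Complex.conj_tsum, ← tsum_mul_left]
  congr 2
  -- reindex `ℤ × ℤ → Λ`, `(m, n) ↦ n i + m`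
  let e : ℤ × ℤ ≃ (Λᵢ).lattice := (Equiv.prodComm ℤ ℤ).trans (Λᵢ).latticeEquivProd.symm.toEquiv
  have he : ∀ p : ℤ × ℤ, ((e p : (Λᵢ).lattice) : ℂ) = (p.2 : ℂ) * I + p.1 := by
    intro p
    simp only [e, Equiv.trans_apply, Equiv.prodComm_apply, LinearEquiv.coe_toEquiv]
    rw [GaussianLattice.coe_latticeEquivProd_symm]
    rfl
  rw [← e.tsum_eq]
  refine tsum_congr fun p ↦ ?_
  rw [he p, toComplex_rep]
  set c₀ : ℂ := (rep M c 0 : ℂ) with hc₀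
  set w : ℂ := (p.2 : ℂ) * I + p.1 with hw
  have hfac : c₀ + (M : ℂ) * w = (M : ℂ) * (c₀ / M + w) := by field_simp
  rw [hfac, norm_mul, Complex.norm_natCast, mul_pow,
    show -y * ((M : ℝ) ^ 2 * ‖c₀ / ↑M + w‖ ^ 2) = -((M : ℝ) ^ 2 * y) * ‖c₀ / ↑M + w‖ ^ 2 by ring]
  rw [mul_comm ((M : ℂ)) (c₀ / ↑M + w), ← div_div, div_eq_mul_inv _ (M : ℂ), mul_comm]

/-- **Limit of a class sum**: as `y → 0⁺` the class sum tends to `ψ(c₀) conj(E₁*(c₀/M))/M`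
(Kronecker's limit formula `GaussianLattice.tendsto_tsum_exp_div_sub` at `z = c₀/M`, after
`y ↦ M²y` and `l ↦ -l`). [folklore] -/
theorem tendsto_tsum_class (hψ : ∀ x y : ℤ[i], ψ (x + M * y) = ψ x) (c : ZMod M × ZMod M) :
    Tendsto (fun y : ℝ ↦ ∑' p : ℤ × ℤ, ψ (rep M c p) * (rep M c p : ℂ) /
        (((rep M c p).norm : ℤ) : ℂ) * ((rexp (-y * (((rep M c p).norm : ℤ) : ℝ)) : ℝ) : ℂ))
      (𝓝[>] 0)
      (𝓝 (ψ (rep M c 0) * conj ((M : ℂ)⁻¹ * kroneckerE₁ ((rep M c 0 : ℂ) / M)))) := by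
  have hMr : (0 : ℝ) < M := by exact_mod_cast Nat.pos_of_ne_zero (NeZero.ne M)
  set z : ℂ := (rep M c 0 : ℂ) / M with hz
  -- Kronecker's limit formula at `z`, in the `z + l` form
  have hK : Tendsto (fun ε : ℝ ↦ ∑' l : (Λᵢ).lattice,
      ((rexp (-ε * ‖z + (l : ℂ)‖ ^ 2) : ℝ) : ℂ) / (z + (l : ℂ))) (𝓝[>] 0)
      (𝓝 (kroneckerE₁ z)) := by
    rw [kroneckerE₁_def]
    refine (GaussianLattice.tendsto_tsum_exp_div_sub z).congr fun ε ↦ ?_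
    rw [← (Equiv.neg _).tsum_eq]
    refine tsum_congr fun l ↦ ?_
    simp only [Equiv.neg_apply, Submodule.coe_neg, sub_neg_eq_add]
  -- substitute `ε = M² y`
  have hK' := hK.comp (tendsto_const_mul_nhdsGT_zero (c := (M : ℝ) ^ 2) (by positivity))
  have h := ((Complex.continuous_conj.tendsto _).comp (hK'.const_mul ((M : ℂ)⁻¹))).const_mul
    (ψ (rep M c 0))
  refine h.congr fun y ↦ ?_
  simp only [Function.comp_apply]
  rw [tsum_class_eq M ψ hψ c y]

/-- **The value at `s = 1` of a weight-one theta `L`-series of `ℤ[i]` as a finite sum of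
Eisenstein–Kronecker numbers**: for `ψ : ℤ[i] → ℂ` periodic modulo `M ≥ 1`,
`L_ψ(1) = M⁻¹ ∑_{c mod M} ψ(c) · conj(E₁*(c/M))`, `E₁*(z) = ζ_{ℤi+ℤ}(z) − π z̄`
(`GaussianLattice.kroneckerE₁`), the sum running over the `M²` classes `c = rep M · 0` of
`ℤ[i]/M`. (Birch–Swinnerton-Dyer 1965, §3, for the Hecke characters of `y² = x³ − Dx`; here for
any periodic coefficient.) [folklore] -/
theorem thetaLFunction_one_eq_sum_kroneckerE₁ (hψ : ∀ x y : ℤ[i], ψ (x + M * y) = ψ x) :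
    thetaLFunction M ψ 1 = (M : ℂ)⁻¹ * ∑ c : ZMod M × ZMod M,
      ψ (rep M c 0) * conj (kroneckerE₁ ((rep M c 0 : ℂ) / M)) := by
  have h1 := tendsto_tsum_thetaLFunction_one M ψ hψ
  -- the same limit, computed class by class
  have h2 : Tendsto (fun y : ℝ ↦ ∑' x : ℤ[i], ψ x * (x : ℂ) / ((x.norm : ℤ) : ℂ) *
      ((rexp (-y * ((x.norm : ℤ) : ℝ)) : ℝ) : ℂ)) (𝓝[>] 0)
      (𝓝 (∑ c : ZMod M × ZMod M,
        ψ (rep M c 0) * conj ((M : ℂ)⁻¹ * kroneckerE₁ ((rep M c 0 : ℂ) / M)))) := by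
    have hs := tendsto_finsetSum (Finset.univ : Finset (ZMod M × ZMod M))
      fun c _ ↦ tendsto_tsum_class M ψ hψ c
    refine hs.congr' ?_
    filter_upwards [self_mem_nhdsWithin] with y hy
    have hy0 : (0 : ℝ) < y := hy
    -- summability of the damped sum over `ℤ[i]`
    have hF : Summable fun x : ℤ[i] ↦ ψ x * (x : ℂ) / ((x.norm : ℤ) : ℂ) *
        ((rexp (-y * ((x.norm : ℤ) : ℝ)) : ℝ) : ℂ) := by
      have hb := norm_le_of_periodic M ψ hψ
      set C : ℝ := ∑ c : ZMod M × ZMod M, ‖ψ (rep M c 0)‖ with hC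
      refine Summable.of_norm_bounded ((summable_exp_neg_mul_norm hy0).mul_left C) fun x ↦ ?_
      rw [summand_eq, norm_mul, Complex.norm_conj, norm_div, Complex.norm_real,
        Real.norm_of_nonneg (Real.exp_pos _).le, norm_toComplex_sq]
      refine mul_le_mul (hb x) ?_ (by positivity) ((norm_nonneg _).trans (hb x))
      rcases eq_or_ne x 0 with rfl | hx
      · simp
      · have h1 : 1 ≤ ‖(x : ℂ)‖ := by
          have := GaussianInt.norm_pos.mpr hx
          have h' : (1 : ℝ) ≤ ((x.norm : ℤ) : ℝ) := by exact_mod_cast this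
          rw [← norm_toComplex_sq] at h'
          nlinarith [norm_nonneg (x : ℂ)]
        exact div_le_self (Real.exp_pos _).le h1
    exact ((hasSum_sum_classes M hF).tsum_eq).symm
  have h3 := tendsto_nhds_unique h1 h2
  rw [h3, Finset.mul_sum]
  refine Finset.sum_congr rfl fun c _ ↦ ?_
  rw [map_mul, map_inv₀, Complex.conj_natCast]
  ring

end ClassSums

/-! ### `L(E_n, 1)` -/

section CongruentNumber

variable {n : ℕ}

/-- **`L(E_n, s) = ¼ L_{ψ_n}(s)` for every admissible period**: if `ψ_n = heckePsi n` is periodic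
modulo `M ≥ 1` (it always is modulo `4n`, `heckePsi_add_mul`), the entire
`L`-function of `E_n` (`n` squarefree) is `¼ · thetaLFunction M ψ_n` (both are entire
continuations of the same Dirichlet series; `WeierstrassCurve.subsingleton_entireContinuations`).
[folklore] -/
theorem entireLFunction_congruentNumberCurve_eq_of_period (hsq : Squarefree n) (M : ℕ) [NeZero M]
    (hψ : ∀ x y : ℤ[i], heckePsi n (x + M * y) = heckePsi n x)
    (s : ℂ) :
    (congruentNumberCurve n).entireLFunction s =
      (1 / 4 : ℂ) * thetaLFunction M (heckePsi n) s := by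
  have hL : (congruentNumberCurve n).HasEntireLFunction :=
    hasEntireLFunction_congruentNumberCurve_holds hsq
  have hmem := (congruentNumberCurve n).entireLFunction_mem hL
  have hmem' : (fun s ↦ (1 / 4 : ℂ) * thetaLFunction M (heckePsi n) s) ∈
      (congruentNumberCurve n).entireContinuations := by
    refine ⟨(differentiable_thetaLFunction M _).const_mul _, fun s hs ↦ ?_⟩
    beta_reduce
    rw [thetaLFunction_eq_LSeries M _ hψ hs, lSeries_congruentNumberCurve_eq hsq
      IrelandRosen1990_card_points_one_mod_four_holds s]
  have := (congruentNumberCurve n).subsingleton_entireContinuations hmem hmem'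
  exact congrFun this s

/-- **`L(E_n, 1)` as a finite sum of Eisenstein–Kronecker numbers of `ℤi + ℤ`**
(Birch–Swinnerton-Dyer 1965, §3, in the present normalisation): for `n` squarefree and any
period `M ≥ 1` of `ψ_n = heckePsi n`,
`L(E_n, 1) = (4M)⁻¹ ∑_{c mod M} ψ_n(c) · conj(E₁*(c/M))`, `E₁*(z) = ζ_{ℤi+ℤ}(z) − π z̄`.
[folklore] -/
theorem entireLFunction_congruentNumberCurve_one_eq_sum (hsq : Squarefree n) (M : ℕ) [NeZero M]
    (hψ : ∀ x y : ℤ[i], heckePsi n (x + M * y) = heckePsi n x) :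
    (congruentNumberCurve n).entireLFunction 1 =
      (1 / 4 : ℂ) * (M : ℂ)⁻¹ * ∑ c : ZMod M × ZMod M,
        heckePsi n (rep M c 0) * conj (kroneckerE₁ ((rep M c 0 : ℂ) / M)) := by
  rw [entireLFunction_congruentNumberCurve_eq_of_period hsq M hψ, thetaLFunction_one_eq_sum_kroneckerE₁ M _ hψ,
    mul_assoc]

end CongruentNumber

end Literature.NumberTheory.EllipticCurves

end
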